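import Summits.HubbardSuperconductivity.HubbardSuperconductivity.Theorems.KLProgrammeKLRegimeScaleZeroCovarianceOffSiteImages
import Summits.HubbardSuperconductivity.HubbardSuperconductivity.Theorems.KLProgrammeKLRegimeScaleZeroCovarianceOffSiteLatticeSeries

/-!
# Route `KLProgramme`, crux K3 — engine-flow child (stmt-HubbardSuperconductivity-20437), stub (C) at `n = 0`, located item #22a «(C)-SCALE0-PT2»,
# THE OFF-SITE DOOR: an off-site entry of the scale-`0` grid covariance `S_gridᵀ C⁰_{>e₀} S_grid` (bare frame, `Λ = klE0`) IS the alternating image sum of the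
# `β = ∞` infinite-lattice kernel, up to the window tail `(19/3)(4+|μ|)β/(2π²M)` and the torus tail — hypothesis-free

Cell gate-hubbard-kl, seat p1 g20.  The assembly of #22a (k3c5-p1 `…FlowReadScaleZeroAssembly`) reads the entries
`A(X,Y) = (hubbardGridSub L M β Nᵀ · hubbardCovAboveCT L M β μ 0 0 klE0 · hubbardGridSub L M β N) X Y`.  By
`hubbardCovAboveCT_zero_seed_eq_normalCovariance_uvSymbolCT` and D7 (`gridCov_uvSymbolCT_apply_zero_one_eq_sum_freq`) the `(+,−)` entry between grid
points `p₁ = (j₁, x₁)`, `p₀ = (j₀, x₀)` of equal spin is the engine's frequency-window sum `Σ_{i∈MatsubaraIdx M} F_L(ω_i)` with `z = val x₁ − val x₀`,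
`Δτ = j₁β/N − j₀β/N ∈ (−β, β)`; chaining (M) (`…OffSiteExplicit`), (L)-summed (`…OffSiteLatticeSeries`) and (β1) (`…OffSiteImages`) gives, for `x₁ ≠ x₀`:

* `torusProj_valSub_eq_sub`, `torusProj_valSub_ne_zero` — `proj(val x₁ − val x₀) = x₁ − x₀ ≠ 0`; `gridTime_sub_mem` — `Δτ ∈ [−β, β]`;
* `gridCov_hubbardCovAboveCT_apply_eq_sum_freqTerm` — the entry as the window sum (spin-diagonal);
* **`norm_gridCov_offSite_sub_images_le_of_nonpos`** (`Δτ ≤ 0`) and **`norm_gridCov_offSite_sub_neg_images_le_of_nonneg`** (`Δτ ≥ 0`):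
  `‖A((p₁,σ,+),(p₀,σ,−)) ∓ (1/2π)Σ'_m (−1)^m 𝓕G((mβ + τ*)/2π)‖ ≤ (19/3)(4+|μ|+‖0‖₀)·β/(2π²M) + D₀(N′)·(2/klE0)·(2/(2R+2))^{N′−4}·4C₂/(2π)^{N′}`
  with `τ* = −Δτ` resp. `β − Δτ`, `G(ω) = a¹_ω(−z)` the infinite-lattice kernel of the `c = 1` UV symbol at `K = 0`, `Λ = klE0`, for every `N′ ≥ 4`, every box
  radius `R` and every `L ≥ R + 1 + Σ_j|z_j|` — the certified object of SPEC v2 §2a/§2c (`ǧ(t) = (1/2π)𝓕G(t/2π)` = `C_∞(−z, t)`);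
* §3 (appended) `…_of_proj_eq` twins with ANY representative `z` of `x₁ − x₀` (use the CENTRED one, `|z_j| ≤ L/2`, so the torus-tail condition
  `R + 1 + Σ|z_j| ≤ L` leaves `R ≈ L/2`; with the raw `val x₁ − val x₀` it can be vacuous across the boundary wrap).

Proofs only; no definitions; nothing here asserts (C), any stub of 20437, K3 or superconductivity.  References: BGM 2006 §2.1 (2.3)–(2.6a)
[cite: BenfattoGiulianiMastropietro2006]; Salmhofer 1999 §4.2.4–§4.2.5 [cite: Salmhofer1999].
-/

noncomputable section

namespace Summit.HubbardSuperconductivity.HubbardSuperconductivity.Theorems.KLRegimeSplit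

set_option linter.dupNamespace false -- summit = problem name (single-conjunct summit), D-0017

open Literature.MathematicalPhysics.QuantumLattice Literature.Probability.LatticeModels Literature.Analysis.FunctionSpaces
open Summit.HubbardSuperconductivity.HubbardSuperconductivity.Theorems.DispersionFlow
open MeasureTheory Set Finset Complex UnitAddTorus Real
open scoped FourierTransform Nat

variable {L M : ℕ} [NeZero L]

/-! ## §1 Bookkeeping: the torus difference, the time difference, the entry as the window sum -/

/-- `proj(val x₁ − val x₀) = x₁ − x₀` on the discrete torus. -/
theorem torusProj_valSub_eq_sub (x₁ x₀ : TorusSite 2 L) :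
    Torus.proj L (fun j => ((x₁ j).val : ℤ) - (x₀ j).val) = x₁ - x₀ := by
  funext j
  simp [Literature.Probability.LatticeModels.Torus.proj_apply]

/-- Distinct sites have a nonzero torus difference: `x₁ ≠ x₀ ⟹ proj(val x₁ − val x₀) ≠ 0`. -/
theorem torusProj_valSub_ne_zero {x₁ x₀ : TorusSite 2 L} (h : x₁ ≠ x₀) :
    Torus.proj L (fun j => ((x₁ j).val : ℤ) - (x₀ j).val) ≠ 0 := by
  rw [torusProj_valSub_eq_sub]; exact sub_ne_zero.2 h

/-- The integer difference vector is nonzero as well. -/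
theorem valSub_ne_zero {x₁ x₀ : TorusSite 2 L} (h : x₁ ≠ x₀) : (fun j => ((x₁ j).val : ℤ) - (x₀ j).val) ≠ 0 := by
  intro h0
  apply torusProj_valSub_ne_zero h
  rw [h0]
  funext j; simp [Literature.Probability.LatticeModels.Torus.proj_apply]

/-- Grid times differ by at most `β`: `j₁β/N − j₀β/N ∈ [−β, β]` (`0 ≤ β`). -/
theorem gridTime_sub_mem {β : ℝ} (hβ : 0 ≤ β) {N : ℕ} (j₁ j₀ : Fin N) :
    -β ≤ gridTime β N j₁ - gridTime β N j₀ ∧ gridTime β N j₁ - gridTime β N j₀ ≤ β := by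
  have h1 : ∀ j : Fin N, 0 ≤ gridTime β N j ∧ gridTime β N j ≤ β := fun j => by
    have hN : (0 : ℝ) < N := by exact_mod_cast (Nat.pos_of_ne_zero fun h => (Fin.pos j).ne' h)
    have hj : ((j : ℕ) : ℝ) ≤ N := by exact_mod_cast j.isLt.le
    refine ⟨by unfold gridTime; positivity, ?_⟩
    unfold gridTime
    rw [div_le_iff₀ hN]
    nlinarith
  constructor <;> linarith [(h1 j₁).1, (h1 j₁).2, (h1 j₀).1, (h1 j₀).2]

/-- **The `(+,−)` entry of `S_gridᵀ C⁰_{>e₀} S_grid` (bare frame) between grid points of equal spin is the engine's window sum**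
`Σ_{i∈MatsubaraIdx M} (βL²)⁻² e^{iω_iΔτ} Σ_k χ_k(proj(val x₁ − val x₀)) Ψ_{βL²}(ω_i, e_0(k))`, `Δτ = j₁β/N − j₀β/N` (`0 < β`). -/
theorem gridCov_hubbardCovAboveCT_apply_eq_sum_freqTerm {β : ℝ} (hβ : 0 < β) (μ Λ : ℝ) {N : ℕ} (p₁ p₀ : GridPoint L N) (σ : Fin 2) :
    ((hubbardGridSub L M β N).transpose * hubbardCovAboveCT L M β μ 0 0 Λ * hubbardGridSub L M β N) ((p₁, σ), 0) ((p₀, σ), 1) =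
      ∑ i : MatsubaraIdx M, ((1 / (β * (L : ℝ) ^ 2) : ℝ) : ℂ) ^ 2 *
        cexp (I * ((matsubaraFreq β M i * (gridTime β N p₁.1 - gridTime β N p₀.1) : ℝ) : ℂ)) *
          ∑ kv : TorusSite 2 L, torusChar kv (Torus.proj L fun j => ((p₁.2 j).val : ℤ) - (p₀.2 j).val) *
            uvSymbolFn (β * (L : ℝ) ^ 2) Λ (nambuXiCT L μ 0 kv) (matsubaraFreq β M i) := by
  rw [hubbardCovAboveCT_zero_seed_eq_normalCovariance_uvSymbolCT, hubbardGridSub,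
    gridCov_uvSymbolCT_apply_zero_one_eq_sum_freq hβ μ 0 Λ (fun p : GridPoint L N => p.2) (fun p => gridTime β N p.1) p₁ p₀ σ σ, if_pos rfl]

/-! ## §2 The off-site door -/

/-- **OFF-SITE DOOR, `Δτ ≤ 0`** (bare frame `K = 0`, `Λ = klE0`, table-free): for grid points `p₁ = (j₁,x₁)`, `p₀ = (j₀,x₀)` with `x₁ ≠ x₀` and
`Δτ = j₁β/N − j₀β/N ≤ 0`, `0 < β`, `1 ≤ M`, every `N′ ≥ 4`, every box radius `R` and every `L ≥ R + 1 + Σ_j|z_j|` (`z = val x₁ − val x₀`):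
`‖A((p₁,σ,+),(p₀,σ,−)) − (1/2π)Σ'_m (−1)^m 𝓕G((mβ − Δτ)/2π)‖ ≤ (19/3)(4+|μ|+‖0‖₀)β/(2π²M) + D₀(N′)(2/klE0)(2/(2R+2))^{N′−4}4C₂/(2π)^{N′}`,
`G(ω) = a¹_ω(−z)`, `D₀(N′) = N′!·klChi2CauchyTab N′·(N′+1)!·4·max(1,4/klE0)^{N′−1}·(8π)^{N′}`. -/
theorem norm_gridCov_offSite_sub_images_le_of_nonpos {β : ℝ} (hβ : 0 < β) (hM : 0 < M) (μ : ℝ) {N : ℕ} {p₁ p₀ : GridPoint L N}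
    (hx : p₁.2 ≠ p₀.2) (hΔ : gridTime β N p₁.1 - gridTime β N p₀.1 ≤ 0) (σ : Fin 2) {N' : ℕ} (hN' : 2 * 2 ≤ N') {R : ℕ}
    (hR : (R : ℤ) + 1 + ∑ j, |((p₁.2 j).val : ℤ) - (p₀.2 j).val| ≤ L) :
    ‖((hubbardGridSub L M β N).transpose * hubbardCovAboveCT L M β μ 0 0 klE0 * hubbardGridSub L M β N) ((p₁, σ), 0) ((p₀, σ), 1) -
        ((1 / (2 * π) : ℝ) : ℂ) * ∑' m : ℤ, (-1 : ℂ) ^ m * 𝓕 (fun om : ℝ => mFourierCoeff (Torus.descend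
          (fun y : Momentum => uvSymbolFn 1 klE0 (frameLevel μ 0 ((2 * π) • y)) om) (uvSpatialSymbol_isLatticePeriodic 1 klE0 μ 0 om))
          (-(fun j => ((p₁.2 j).val : ℤ) - (p₀.2 j).val))) ((m * β + -(gridTime β N p₁.1 - gridTime β N p₀.1)) / (2 * π))‖ ≤
      (19 / 3) * (4 + |μ| + (0 : TrigPolyC4v).coeffNorm 0) * β / (2 * π ^ 2 * M) +
        (N' ! * klChi2CauchyTab N' * (N' + 1) ! * 4 * (max 1 (4 / klE0)) ^ (N' - 1) * ((2 * π) * 4) ^ N') * (2 / klE0) *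
          (1 / (2 * Real.pi) ^ N' * (2 / ((2 * R + 2 : ℕ) : ℝ)) ^ (N' - 2 * 2) * (2 ^ 2 * ∑' k : Site 2, ∏ j, (1 + (k j : ℝ) ^ 2)⁻¹)) := by
  have hz : Torus.proj L (fun j => ((p₁.2 j).val : ℤ) - (p₀.2 j).val) ≠ 0 := torusProj_valSub_ne_zero hx
  have hz' : -(fun j => ((p₁.2 j).val : ℤ) - (p₀.2 j).val) ≠ 0 := neg_ne_zero.2 (valSub_ne_zero hx)
  have hE0 : (0 : ℝ) < klE0 := by norm_num [klE0]
  obtain ⟨hlo, -⟩ := gridTime_sub_mem hβ.le p₁.1 p₀.1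
  rw [gridCov_hubbardCovAboveCT_apply_eq_sum_freqTerm hβ μ klE0 p₁ p₀ σ,
    ← tsum_kernelTerm_eq_tsum_images_bare_of_nonpos zero_le_one hE0 μ hz' hβ hΔ hlo]
  exact norm_sum_freqTerm_sub_tsum_kernelTerm_le_bare hβ hE0 hM μ _ hN' hz hR

/-- **OFF-SITE DOOR, `Δτ ≥ 0`** (bare frame `K = 0`, `Λ = klE0`, table-free): as above with `0 ≤ Δτ = j₁β/N − j₀β/N`, the image sum carrying the sign of
antiperiodicity: `‖A((p₁,σ,+),(p₀,σ,−)) + (1/2π)Σ'_m (−1)^m 𝓕G((mβ + (β − Δτ))/2π)‖ ≤ (same two tails)`. -/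
theorem norm_gridCov_offSite_sub_neg_images_le_of_nonneg {β : ℝ} (hβ : 0 < β) (hM : 0 < M) (μ : ℝ) {N : ℕ} {p₁ p₀ : GridPoint L N}
    (hx : p₁.2 ≠ p₀.2) (hΔ : 0 ≤ gridTime β N p₁.1 - gridTime β N p₀.1) (σ : Fin 2) {N' : ℕ} (hN' : 2 * 2 ≤ N') {R : ℕ}
    (hR : (R : ℤ) + 1 + ∑ j, |((p₁.2 j).val : ℤ) - (p₀.2 j).val| ≤ L) :
    ‖((hubbardGridSub L M β N).transpose * hubbardCovAboveCT L M β μ 0 0 klE0 * hubbardGridSub L M β N) ((p₁, σ), 0) ((p₀, σ), 1) -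
        -(((1 / (2 * π) : ℝ) : ℂ) * ∑' m : ℤ, (-1 : ℂ) ^ m * 𝓕 (fun om : ℝ => mFourierCoeff (Torus.descend
          (fun y : Momentum => uvSymbolFn 1 klE0 (frameLevel μ 0 ((2 * π) • y)) om) (uvSpatialSymbol_isLatticePeriodic 1 klE0 μ 0 om))
          (-(fun j => ((p₁.2 j).val : ℤ) - (p₀.2 j).val))) ((m * β + (β - (gridTime β N p₁.1 - gridTime β N p₀.1))) / (2 * π)))‖ ≤
      (19 / 3) * (4 + |μ| + (0 : TrigPolyC4v).coeffNorm 0) * β / (2 * π ^ 2 * M) +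
        (N' ! * klChi2CauchyTab N' * (N' + 1) ! * 4 * (max 1 (4 / klE0)) ^ (N' - 1) * ((2 * π) * 4) ^ N') * (2 / klE0) *
          (1 / (2 * Real.pi) ^ N' * (2 / ((2 * R + 2 : ℕ) : ℝ)) ^ (N' - 2 * 2) * (2 ^ 2 * ∑' k : Site 2, ∏ j, (1 + (k j : ℝ) ^ 2)⁻¹)) := by
  have hz : Torus.proj L (fun j => ((p₁.2 j).val : ℤ) - (p₀.2 j).val) ≠ 0 := torusProj_valSub_ne_zero hx
  have hz' : -(fun j => ((p₁.2 j).val : ℤ) - (p₀.2 j).val) ≠ 0 := neg_ne_zero.2 (valSub_ne_zero hx)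
  have hE0 : (0 : ℝ) < klE0 := by norm_num [klE0]
  obtain ⟨-, hhi⟩ := gridTime_sub_mem hβ.le p₁.1 p₀.1
  rw [gridCov_hubbardCovAboveCT_apply_eq_sum_freqTerm hβ μ klE0 p₁ p₀ σ,
    ← tsum_kernelTerm_eq_neg_tsum_images_bare_of_nonneg zero_le_one hE0 μ hz' hβ hΔ hhi]
  exact norm_sum_freqTerm_sub_tsum_kernelTerm_le_bare hβ hE0 hM μ _ hN' hz hR


/-! ## §3 The door with ANY representative of the torus difference (use the CENTRED one: the torus tail needs `R + 1 + Σ|z_j| ≤ L`) -/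

/-- **OFF-SITE DOOR, `Δτ ≤ 0`, any representative**: as `norm_gridCov_offSite_sub_images_le_of_nonpos`, with the kernel `G = a¹_·(−z)` and the torus-tail
condition read on ANY integer vector `z` with `proj z = x₁ − x₀` (take `z_j = valMinAbs((x₁ − x₀)_j)`, `|z_j| ≤ L/2`, so that `R` can be `≈ L/2 − 1 − |z|₁`). -/
theorem norm_gridCov_offSite_sub_images_le_of_nonpos_of_proj_eq {β : ℝ} (hβ : 0 < β) (hM : 0 < M) (μ : ℝ) {N : ℕ} {p₁ p₀ : GridPoint L N}
    (hx : p₁.2 ≠ p₀.2) {z : Site 2} (hzx : Torus.proj L z = p₁.2 - p₀.2) (hΔ : gridTime β N p₁.1 - gridTime β N p₀.1 ≤ 0) (σ : Fin 2) {N' : ℕ}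
    (hN' : 2 * 2 ≤ N') {R : ℕ} (hR : (R : ℤ) + 1 + ∑ j, |z j| ≤ L) :
    ‖((hubbardGridSub L M β N).transpose * hubbardCovAboveCT L M β μ 0 0 klE0 * hubbardGridSub L M β N) ((p₁, σ), 0) ((p₀, σ), 1) -
        ((1 / (2 * π) : ℝ) : ℂ) * ∑' m : ℤ, (-1 : ℂ) ^ m * 𝓕 (fun om : ℝ => mFourierCoeff (Torus.descend
          (fun y : Momentum => uvSymbolFn 1 klE0 (frameLevel μ 0 ((2 * π) • y)) om) (uvSpatialSymbol_isLatticePeriodic 1 klE0 μ 0 om))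
          (-z)) ((m * β + -(gridTime β N p₁.1 - gridTime β N p₀.1)) / (2 * π))‖ ≤
      (19 / 3) * (4 + |μ| + (0 : TrigPolyC4v).coeffNorm 0) * β / (2 * π ^ 2 * M) +
        (N' ! * klChi2CauchyTab N' * (N' + 1) ! * 4 * (max 1 (4 / klE0)) ^ (N' - 1) * ((2 * π) * 4) ^ N') * (2 / klE0) *
          (1 / (2 * Real.pi) ^ N' * (2 / ((2 * R + 2 : ℕ) : ℝ)) ^ (N' - 2 * 2) * (2 ^ 2 * ∑' k : Site 2, ∏ j, (1 + (k j : ℝ) ^ 2)⁻¹)) := by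
  have hE0 : (0 : ℝ) < klE0 := by norm_num [klE0]
  have hz : Torus.proj L z ≠ 0 := by rw [hzx]; exact sub_ne_zero.2 hx
  have hz' : -z ≠ 0 := by
    intro h0; apply hz; rw [neg_eq_zero.1 h0]; funext j; simp [Literature.Probability.LatticeModels.Torus.proj_apply]
  obtain ⟨hlo, -⟩ := gridTime_sub_mem hβ.le p₁.1 p₀.1
  rw [gridCov_hubbardCovAboveCT_apply_eq_sum_freqTerm hβ μ klE0 p₁ p₀ σ, torusProj_valSub_eq_sub, ← hzx,
    ← tsum_kernelTerm_eq_tsum_images_bare_of_nonpos zero_le_one hE0 μ hz' hβ hΔ hlo]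
  exact norm_sum_freqTerm_sub_tsum_kernelTerm_le_bare hβ hE0 hM μ _ hN' hz hR

/-- **OFF-SITE DOOR, `Δτ ≥ 0`, any representative** (see `…_of_nonpos_of_proj_eq`). -/
theorem norm_gridCov_offSite_sub_neg_images_le_of_nonneg_of_proj_eq {β : ℝ} (hβ : 0 < β) (hM : 0 < M) (μ : ℝ) {N : ℕ} {p₁ p₀ : GridPoint L N}
    (hx : p₁.2 ≠ p₀.2) {z : Site 2} (hzx : Torus.proj L z = p₁.2 - p₀.2) (hΔ : 0 ≤ gridTime β N p₁.1 - gridTime β N p₀.1) (σ : Fin 2) {N' : ℕ}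
    (hN' : 2 * 2 ≤ N') {R : ℕ} (hR : (R : ℤ) + 1 + ∑ j, |z j| ≤ L) :
    ‖((hubbardGridSub L M β N).transpose * hubbardCovAboveCT L M β μ 0 0 klE0 * hubbardGridSub L M β N) ((p₁, σ), 0) ((p₀, σ), 1) -
        -(((1 / (2 * π) : ℝ) : ℂ) * ∑' m : ℤ, (-1 : ℂ) ^ m * 𝓕 (fun om : ℝ => mFourierCoeff (Torus.descend
          (fun y : Momentum => uvSymbolFn 1 klE0 (frameLevel μ 0 ((2 * π) • y)) om) (uvSpatialSymbol_isLatticePeriodic 1 klE0 μ 0 om))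
          (-z)) ((m * β + (β - (gridTime β N p₁.1 - gridTime β N p₀.1))) / (2 * π)))‖ ≤
      (19 / 3) * (4 + |μ| + (0 : TrigPolyC4v).coeffNorm 0) * β / (2 * π ^ 2 * M) +
        (N' ! * klChi2CauchyTab N' * (N' + 1) ! * 4 * (max 1 (4 / klE0)) ^ (N' - 1) * ((2 * π) * 4) ^ N') * (2 / klE0) *
          (1 / (2 * Real.pi) ^ N' * (2 / ((2 * R + 2 : ℕ) : ℝ)) ^ (N' - 2 * 2) * (2 ^ 2 * ∑' k : Site 2, ∏ j, (1 + (k j : ℝ) ^ 2)⁻¹)) := by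
  have hE0 : (0 : ℝ) < klE0 := by norm_num [klE0]
  have hz : Torus.proj L z ≠ 0 := by rw [hzx]; exact sub_ne_zero.2 hx
  have hz' : -z ≠ 0 := by
    intro h0; apply hz; rw [neg_eq_zero.1 h0]; funext j; simp [Literature.Probability.LatticeModels.Torus.proj_apply]
  obtain ⟨-, hhi⟩ := gridTime_sub_mem hβ.le p₁.1 p₀.1
  rw [gridCov_hubbardCovAboveCT_apply_eq_sum_freqTerm hβ μ klE0 p₁ p₀ σ, torusProj_valSub_eq_sub, ← hzx,
    ← tsum_kernelTerm_eq_neg_tsum_images_bare_of_nonneg zero_le_one hE0 μ hz' hβ hΔ hhi]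
  exact norm_sum_freqTerm_sub_tsum_kernelTerm_le_bare hβ hE0 hM μ _ hN' hz hR

end Summit.HubbardSuperconductivity.HubbardSuperconductivity.Theorems.KLRegimeSplit

end
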